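import Summits.CriticalPhenomena.PercolationContinuityZ3.Theses.PercNonProliferation
import Summits.CriticalPhenomena.PercolationContinuityZ3.Theorems.NonProliferation.Negative.AboveSix
import Summits.CriticalPhenomena.PercolationContinuityZ3.Theorems.PercNonProliferationNonProliferationStubBoundaryGrid
import Summits.CriticalPhenomena.PercolationContinuityZ3.Theorems.PercNonProliferationNonProliferationStubInnerCellCount
import Summits.CriticalPhenomena.PercolationContinuityZ3.Theorems.PercNonProliferationNonProliferationStubInnerTwoArmDecay
import Summits.CriticalPhenomena.PercolationContinuityZ3.Theorems.PercNonProliferationNonProliferationStubLayerCake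
import Literature.Probability.Percolation.RSW
import HarnessLib

/-!
# Crux `PercNonProliferation.NonProliferation` (stmt-CriticalPhenomena-4444), line `boundary-pinning` —
# the unconditional support theorem `PowerCap`: `E_{p_c(ℤ³)} N_n ≤ C n^{2-β}`

Lead's composition file for line `boundary-pinning` (payload slug `Sketch`,
prover-line-stmt-CriticalPhenomena-4444-c1; skeleton `Cruxes/NonProliferation/Lines/boundary_pinning.lean`,
theorem `powerCap_of`). Lands with `--supports stmt-CriticalPhenomena-4444`: it does not close the crux
(which asks for a BOUNDED number of spanning clusters with positive probability) but it is the first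
power saving on the mean number of annulus-spanning box-clusters at `p_c(ℤ³)` in the tree, improving the
route file's only unconditional cap `E N_n = o(n²)` (BGN).

`expected_numSpanning_le_rpow` — there are `β > 0` and `C` with
`Σ_{k < #B(n)} P_{p_c(ℤ³)}(repEvent 3 k n) ≤ C n^{2-β}` for all `n ≥ 1`; the left side is
`E_{p_c} N_n` (layer cake over the antitone events `repEvent 3 k n = {N_n ≥ k+1}`, `N_n ≤ #B(n)`).

Proof (ideator 5's `PowerCap` sketch, triage-endorsed; every ingredient landed as a stub of the line):
cells of side `s = ⌊n^{α/3}⌋` covering the INNER sphere `∂ⁱⁿB(n)` (`stub_boundaryGrid` at radius `n`: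
`≤ 6(2n/s+2)² ≤ 216 n^{2-2α/3}` cells of coordinate-diameter `< s` and size `≤ s³`); every crosser is
charged to the cell of the first exit of its crossing path through `∂ⁱⁿB(n)`, so that on lattice
configurations `N_n ≤ #cells + Σ_cells |cell|·1[two box-distinct crossers through the cell]`
(`stub_innerCellCount`); two box-distinct crossers through one cell of diameter `≤ ⌊n^α⌋` violate the
translated DKT/Cerf uniqueness zone, probability `≤ n^{-α}` (`stub_innerTwoArmDecay`, from the in-tree
`dkt_prop1`); the finite layer cake (`stub_layerCake`) integrates: `E N_n ≤ #cells (1 + s³ n^{-α}) ≤ 2·#cells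
≤ 432 n^{2-2α/3}`; small `n` are absorbed in the constant. Here `α` is `min(α_DKT, 1)` and `β = 2α/3`.
-/

noncomputable section

namespace Summit.CriticalPhenomena.PercolationContinuityZ3.Theorems.NonProliferation

open MeasureTheory Filter Topology
open Literature.Probability.LatticeModels Literature.Probability.Percolation
open Summit.CriticalPhenomena.PercolationContinuityZ3.Theorems.NonProliferation.Negative

namespace PowerCap

/-- The inner two-DISTINCT-crosser event of a cell `Q` (two points `u, v ∈ Q`, each joined inside `B(2n)`
to `∂ⁱⁿB(2n)`, not joined to each other inside `B(2n)`) is measurable: finitely many `u, v, a, b`, and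
`{x ↔ y in S}` is a cylinder event of the finite box. -/
theorem measurableSet_innerTwoArm (d n : ℕ) (Q : Finset (Site d)) :
    MeasurableSet {ω : BondConfig (Site d) | ∃ u ∈ Q, ∃ v ∈ Q,
      (∃ a ∈ innerBoundary (zdGraph d) (box d (2 * n)),
        ω ∈ openConnIn (↑(box d (2 * n)) : Set (Site d)) u a) ∧
      (∃ b ∈ innerBoundary (zdGraph d) (box d (2 * n)),
        ω ∈ openConnIn (↑(box d (2 * n)) : Set (Site d)) v b) ∧
      ω ∉ openConnIn (↑(box d (2 * n)) : Set (Site d)) u v} := by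
  refine measurableSet_setOf.2 (Measurable.exists fun u => measurable_const.and
    (Measurable.exists fun v => measurable_const.and ((Measurable.exists fun a =>
      measurable_const.and ?_).and ((Measurable.exists fun b => measurable_const.and ?_).and
        (Measurable.not ?_)))))
  · exact (PlanarDuality.determinedBy_openConnIn (box d (2 * n)) u a).measurableSet_of_finset.mem
  · exact (PlanarDuality.determinedBy_openConnIn (box d (2 * n)) v b).measurableSet_of_finset.mem
  · exact (PlanarDuality.determinedBy_openConnIn (box d (2 * n)) u v).measurableSet_of_finset.mem

end PowerCap

/-- **`PowerCap`: `E_{p_c(ℤ³)} N_n ≤ C n^{2-β}` for some `β > 0`.** There are `β > 0` and `C` such that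
for every `n ≥ 1`, `Σ_{k < #B(n)} P_{p_c(ℤ³)}(repEvent 3 k n) ≤ C n^{2-β}` — the left side being the mean
number of clusters of the open graph induced on `B(2n)` that meet both `B(n)` and `∂ⁱⁿB(2n)`. Cells of side
`⌊n^{α/3}⌋` on `∂ⁱⁿB(n)` (`stub_boundaryGrid`), the deterministic count (`stub_innerCellCount`, a.e. since
`P_{p_c}` is carried by lattice configurations), the DKT/Cerf cell decay `≤ n^{-α}` (`stub_innerTwoArmDecay`)
and the layer cake (`stub_layerCake`) give `≤ 432 n^{2-2α/3}` for large `n`. -/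
theorem expected_numSpanning_le_rpow :
    ∃ β C : ℝ, 0 < β ∧ ∀ n : ℕ, 1 ≤ n →
      ∑ k ∈ Finset.range (box 3 n).card,
        (bondPercolation (zdGraph 3) (criticalProbI 3)).real (repEvent 3 k n) ≤ C * (n : ℝ) ^ (2 - β) := by
  set μ : Measure (BondConfig (Site 3)) := bondPercolation (zdGraph 3) (criticalProbI 3) with hμ
  -- the event of `stub_innerCellCount` / `stub_innerTwoArmDecay`, as a function of the cell
  set B : ℕ → Finset (Site 3) → Set (BondConfig (Site 3)) := fun n Q =>
    {ω | ∃ u ∈ Q, ∃ v ∈ Q,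
      (∃ a ∈ innerBoundary (zdGraph 3) (box 3 (2 * n)),
        ω ∈ openConnIn (↑(box 3 (2 * n)) : Set (Site 3)) u a) ∧
      (∃ b ∈ innerBoundary (zdGraph 3) (box 3 (2 * n)),
        ω ∈ openConnIn (↑(box 3 (2 * n)) : Set (Site 3)) v b) ∧
      ω ∉ openConnIn (↑(box 3 (2 * n)) : Set (Site 3)) u v} with hB
  obtain ⟨α₀, hα₀, n₁, hdec₀⟩ := stub_innerTwoArmDecay 3 (by norm_num)
  set α : ℝ := min α₀ 1 with hα
  have hα0 : 0 < α := lt_min hα₀ one_pos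
  have hα1 : α ≤ 1 := min_le_right _ _
  have hαle : α ≤ α₀ := min_le_left _ _
  -- the decay stub at the (possibly smaller) exponent `α ≤ 1`
  have hdec : ∀ n : ℕ, n₁ ≤ n → 1 ≤ n → ∀ Q : Finset (Site 3), Q ⊆ box 3 n →
      (∀ u ∈ Q, ∀ v ∈ Q, ∀ i : Fin 3, |u i - v i| ≤ ((⌊(n : ℝ) ^ α⌋₊ : ℕ) : ℤ)) →
      μ.real (B n Q) ≤ (n : ℝ) ^ (-α) := by
    intro n hn hn1 Q hQ hdiam
    have hn1' : (1 : ℝ) ≤ n := by exact_mod_cast hn1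
    have hfl : ⌊(n : ℝ) ^ α⌋₊ ≤ ⌊(n : ℝ) ^ α₀⌋₊ :=
      Nat.floor_mono (Real.rpow_le_rpow_of_exponent_le hn1' hαle)
    have hfl' : ((⌊(n : ℝ) ^ α⌋₊ : ℕ) : ℤ) ≤ ((⌊(n : ℝ) ^ α₀⌋₊ : ℕ) : ℤ) := by exact_mod_cast hfl
    calc μ.real (B n Q) ≤ (n : ℝ) ^ (-α₀) :=
          hdec₀ n hn Q hQ fun u hu v hv i => (hdiam u hu v hv i).trans hfl'
      _ ≤ (n : ℝ) ^ (-α) := Real.rpow_le_rpow_of_exponent_le hn1' (by linarith)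
  set n₂ : ℕ := max n₁ 1 with hn₂
  refine ⟨2 * α / 3, 432 + (2 * (n₂ : ℝ) + 1) ^ 3, by positivity, fun n hn => ?_⟩
  have hn0 : (0 : ℝ) < n := by exact_mod_cast hn
  have hn1 : (1 : ℝ) ≤ n := by exact_mod_cast hn
  have hβ2 : (0 : ℝ) ≤ 2 - 2 * α / 3 := by linarith
  have hpow1 : (1 : ℝ) ≤ (n : ℝ) ^ (2 - 2 * α / 3) := Real.one_le_rpow hn1 hβ2
  have hC0 : (0 : ℝ) ≤ 432 + (2 * (n₂ : ℝ) + 1) ^ 3 := by positivity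
  rcases Nat.lt_or_ge n n₂ with hlt | hge
  · -- small `n`: every term is `≤ 1`
    calc ∑ k ∈ Finset.range (box 3 n).card, μ.real (repEvent 3 k n)
        ≤ ∑ k ∈ Finset.range (box 3 n).card, (1 : ℝ) :=
          Finset.sum_le_sum fun k _ => measureReal_le_one
      _ = (2 * (n : ℝ) + 1) ^ 3 := by
          rw [Finset.sum_const, Finset.card_range, nsmul_eq_mul, mul_one, card_box]; push_cast; ring
      _ ≤ (2 * (n₂ : ℝ) + 1) ^ 3 := by
          have hle : (n : ℝ) ≤ n₂ := by exact_mod_cast hlt.le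
          gcongr
      _ ≤ (432 + (2 * (n₂ : ℝ) + 1) ^ 3) * 1 := by linarith
      _ ≤ (432 + (2 * (n₂ : ℝ) + 1) ^ 3) * (n : ℝ) ^ (2 - 2 * α / 3) := by gcongr
  · -- large `n`
    have hn₁ : n₁ ≤ n := le_trans (le_max_left _ _) hge
    set s : ℕ := ⌊(n : ℝ) ^ (α / 3)⌋₊ with hs
    have hnα3 : (1 : ℝ) ≤ (n : ℝ) ^ (α / 3) := Real.one_le_rpow hn1 (by positivity)
    have hs1 : 1 ≤ s := by rw [hs, Nat.one_le_floor_iff]; exact hnα3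
    have hs_pos : (0 : ℝ) < s := by exact_mod_cast hs1
    have hs_le : (s : ℝ) ≤ (n : ℝ) ^ (α / 3) := Nat.floor_le (by positivity)
    have hs_ge : (n : ℝ) ^ (α / 3) / 2 ≤ s := by
      have h1 : (n : ℝ) ^ (α / 3) - 1 < s := by rw [hs]; exact Nat.sub_one_lt_floor _
      have h2 : (1 : ℝ) ≤ s := by exact_mod_cast hs1
      by_cases h : (2 : ℝ) ≤ (n : ℝ) ^ (α / 3)
      · linarith
      · linarith
    obtain ⟨𝒬, hsub, hdiam, hcardQ, hcov, hcount⟩ := stub_boundaryGrid 3 n s hs1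
    -- `s³ ≤ n^α`
    have hs3 : (s : ℝ) ^ 3 ≤ (n : ℝ) ^ α := by
      calc (s : ℝ) ^ 3 ≤ ((n : ℝ) ^ (α / 3)) ^ 3 := by gcongr
        _ = (n : ℝ) ^ α := by
            rw [← Real.rpow_natCast, ← Real.rpow_mul hn0.le]; norm_num
    -- the cells fit the decay stub: coordinate-diameter `≤ s - 1 ≤ ⌊n^α⌋`
    have hsα : s ≤ ⌊(n : ℝ) ^ α⌋₊ := by
      rw [hs]; exact Nat.floor_mono (Real.rpow_le_rpow_of_exponent_le hn1 (by linarith))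
    have hdec' : ∀ Q ∈ 𝒬, μ.real (B n Q) ≤ (n : ℝ) ^ (-α) := by
      intro Q hQ
      refine hdec n hn₁ hn Q (fun x hx => (mem_innerBoundary_iff.1 (hsub Q hQ hx)).1)
        fun u hu v hv i => ?_
      have h1 := hdiam Q hQ u hu v hv i
      have h2 : (s : ℤ) ≤ ((⌊(n : ℝ) ^ α⌋₊ : ℕ) : ℤ) := by exact_mod_cast hsα
      linarith
    -- layer cake with the deterministic count (a.e.: `P_{p_c}` lives on lattice configurations)
    have hae : ∀ᵐ ω ∂μ, ∀ k < (box 3 n).card, ω ∈ repEvent 3 k n →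
        (k + 1 : ℝ) ≤ 𝒬.card + ∑ Q ∈ 𝒬, (B n Q).indicator (fun _ => (Q.card : ℝ)) ω := by
      filter_upwards [ae_subset_edgeSet (zdGraph 3) (criticalProbI 3)] with ω hω
      intro k _ hk
      exact stub_innerCellCount 3 n k 𝒬 ω hn hω hcov hk
    have hLC := stub_layerCake 3 μ (box 3 n).card (fun k => repEvent 3 k n) 𝒬 (fun Q => B n Q)
      𝒬.card (fun Q => (Q.card : ℝ)) (fun k => measurableSet_repEvent 3 k n)
      (fun Q => PowerCap.measurableSet_innerTwoArm 3 n Q) (fun k k' hkk' => repEvent_antitone 3 n hkk')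
      (Nat.cast_nonneg _) (fun Q => Nat.cast_nonneg _) hae
    -- the cell terms sum to at most `#cells`
    have hnα : (s : ℝ) ^ 3 * (n : ℝ) ^ (-α) ≤ 1 := by
      rw [Real.rpow_neg hn0.le, ← div_eq_mul_inv, div_le_one (Real.rpow_pos_of_pos hn0 _)]
      exact hs3
    have hcells : ∑ Q ∈ 𝒬, (Q.card : ℝ) * μ.real (B n Q) ≤ 𝒬.card := by
      calc ∑ Q ∈ 𝒬, (Q.card : ℝ) * μ.real (B n Q)
          ≤ ∑ Q ∈ 𝒬, (s : ℝ) ^ 3 * (n : ℝ) ^ (-α) := by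
            refine Finset.sum_le_sum fun Q hQ => ?_
            have hQ3 : (Q.card : ℝ) ≤ (s : ℝ) ^ 3 := by exact_mod_cast hcardQ Q hQ
            exact mul_le_mul hQ3 (hdec' Q hQ) measureReal_nonneg (by positivity)
        _ = 𝒬.card * ((s : ℝ) ^ 3 * (n : ℝ) ^ (-α)) := by rw [Finset.sum_const, nsmul_eq_mul]
        _ ≤ 𝒬.card * 1 := by gcongr
        _ = 𝒬.card := mul_one _
    -- the count: `#cells ≤ 6 (2n/s + 2)² ≤ 216 n^{2 - 2α/3}`
    have hkey : (n : ℝ) ^ (1 - α / 3) * (n : ℝ) ^ (α / 3) = n := by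
      rw [← Real.rpow_add hn0, show (1 - α / 3 + α / 3 : ℝ) = 1 by ring, Real.rpow_one]
    have hA1 : (1 : ℝ) ≤ (n : ℝ) ^ (1 - α / 3) := Real.one_le_rpow hn1 (by linarith)
    have h1 : 2 * (n : ℝ) / s ≤ 4 * (n : ℝ) ^ (1 - α / 3) := by
      rw [div_le_iff₀ hs_pos]
      calc 2 * (n : ℝ) = 4 * (n : ℝ) ^ (1 - α / 3) * ((n : ℝ) ^ (α / 3) / 2) := by
            rw [show 4 * (n : ℝ) ^ (1 - α / 3) * ((n : ℝ) ^ (α / 3) / 2)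
              = 2 * ((n : ℝ) ^ (1 - α / 3) * (n : ℝ) ^ (α / 3)) by ring, hkey]
        _ ≤ 4 * (n : ℝ) ^ (1 - α / 3) * s := by gcongr
    have h2' : 2 * (n : ℝ) / s + 2 ≤ 6 * (n : ℝ) ^ (1 - α / 3) := by linarith
    have hsq : ((n : ℝ) ^ (1 - α / 3)) ^ 2 = (n : ℝ) ^ (2 - 2 * α / 3) := by
      rw [← Real.rpow_natCast, ← Real.rpow_mul hn0.le]; ring_nf
    have hcount' : (𝒬.card : ℝ) ≤ 216 * (n : ℝ) ^ (2 - 2 * α / 3) := by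
      have h0 : (0 : ℝ) ≤ 2 * (n : ℝ) / s + 2 := by positivity
      calc (𝒬.card : ℝ) ≤ 2 * (3 : ℕ) * (2 * (n : ℝ) / s + 2) ^ (3 - 1) := by exact_mod_cast hcount
        _ = 6 * (2 * (n : ℝ) / s + 2) ^ 2 := by norm_num
        _ ≤ 6 * (6 * (n : ℝ) ^ (1 - α / 3)) ^ 2 := by gcongr
        _ = 216 * (n : ℝ) ^ (2 - 2 * α / 3) := by rw [mul_pow, hsq]; ring
    -- assemble
    calc ∑ k ∈ Finset.range (box 3 n).card, μ.real (repEvent 3 k n)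
        ≤ 𝒬.card + ∑ Q ∈ 𝒬, (Q.card : ℝ) * μ.real (B n Q) := hLC
      _ ≤ 𝒬.card + 𝒬.card := by linarith
      _ ≤ 432 * (n : ℝ) ^ (2 - 2 * α / 3) := by linarith
      _ ≤ (432 + (2 * (n₂ : ℝ) + 1) ^ 3) * (n : ℝ) ^ (2 - 2 * α / 3) := by
          gcongr; linarith [pow_nonneg (by positivity : (0 : ℝ) ≤ 2 * (n₂ : ℝ) + 1) 3]

end Summit.CriticalPhenomena.PercolationContinuityZ3.Theorems.NonProliferation

end
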